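import Mathlib
import Literature.MathematicalPhysics.QuantumFieldTheory.Luscher2010.TrivializingMaps
import Literature.MathematicalPhysics.QuantumFieldTheory.Luscher2010.FlowActionSeries
import Summits.Ventures.LatticeQCDFlow.TrivializingMaps.ZeroModes
import HarnessLib

/-!
# Summing Lüscher's flow-action series, I: termwise link calculus and the flow equation (4.5)

HONEST FRAMING: exact (Metropolis-corrected) sampling algorithms for lattice gauge theory; figures
of merit are autocorrelation/cost numbers at stated couplings and volumes; no continuum-physics claim.
Everything below is about smooth functions on the FINITE-dimensional ambient space `M_n(ℂ)^E` of a finite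
periodic lattice and their restrictions to the field manifold `SU(n)^E`.

M. Lüscher, *Trivializing maps, the Wilson flow and the HMC algorithm*, CMP 293 (2010) 899–919
[Luscher2010Trivializing], §4.3: the flow action is sought as a power series `S̃_t = ∑_k t^k S̃^{(k)}`
(4.11) whose coefficients solve the recursion (4.12)–(4.15) (`IsLuscherSeries`); "at the values of `t`, where
the expansion converges" (§4.5(b)) the sum is expected to solve the flow equation `𝓛_t S̃_t = S + Ċ_t` (4.5).
The cited statement `SeriesConvergesFiniteVolume` (file B) packages exactly this, with App. E as the printed
proof of convergence.  THIS FILE proves the SUMMATION STEP abstractly and once and for all, for ANY smooth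
action `S`, ANY basis and ANY smooth Lüscher series, under the only hypothesis that is ever used: summable
majorants, on the field manifold, for the values, the link gradients and the repeated link derivatives
`∂^a_e ∂^a_e S̃^{(k)}` of the coefficients (and for the constants):

* `hasDerivAt_tsum_linkCurve`, `linkDeriv_tsum_coeConfig` — a function series whose link derivatives in an
  `𝔰𝔲(n)` direction have a summable majorant on `SU(n)^E` may be differentiated termwise along that link, at
  every point of the manifold (the link curve `s ↦ e^{sY}U(e)` stays on the manifold, `linkCurve_coeConfig`,
  so manifold bounds suffice; Mathlib's `hasDerivAt_tsum`);
* `linkLap_tsum_coeConfig` — hence Lüscher's Laplacian `Δ = -∑ ∂^a_e∂^a_e` passes through the sum on `SU(n)^E`;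
* `luscherL_tsum_eq` — **the summed series solves (4.5)**: if `(S̃^{(k)}, Ċ^{(k)})` is a smooth Lüscher series of
  a smooth action `S` and `∑_k |t|^k M_j(k) < ∞` for manifold majorants `M₀, M₁, M₂` of
  `|S̃^{(k)}|, |∂^a_e S̃^{(k)}|, |∂^a_e∂^a_e S̃^{(k)}|` and `∑_k |t|^k |Ċ^{(k)}| < ∞`, then
  `𝓛_t (∑_k t^k S̃^{(k)}) = S + ∑_k t^k Ċ^{(k)}` on `SU(n)^E` — by the recursion, order by order, exactly as in
  §4.3: `Δ ∑ t^k S̃^{(k)} = (S + Ċ^{(0)}) + ∑_k t^{k+1}(-∂S·∂S̃^{(k)} + Ċ^{(k+1)})`.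

No convergence CLAIM is made here (that is THEOREM A's business for the Wilson action, used in the companion
file `WilsonFlowActionSeries.lean`); this file is the calculus that turns majorants into the flow equation.
Authored by the pub-lqcd lean-2 seat (cell lqcd-flow, FANOUT row 31 GEN-4). Tags: [ours] = venture work.
-/

noncomputable section

namespace Summit.Ventures.LatticeQCDFlow.TrivializingMaps

open Literature.MathematicalPhysics.QuantumFieldTheory
open Literature.MathematicalPhysics.QuantumFieldTheory.Luscher2010
open scoped Matrix Matrix.Norms.Frobenius ContDiff Topology

namespace SeriesSummation

variable {d L n : ℕ} [NeZero L]

/-! ## §1. Termwise link derivatives of a function series on the field manifold -/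

/-- **Termwise differentiation along a link curve.** Let `f_k` be differentiable functionals whose link
derivatives `∂_{e,Y} f_k` (`Y ∈ 𝔰𝔲(n)`) are bounded on `SU(n)^E` by a summable sequence `u_k`, and let
`∑_k f_k(ιU)` converge at the field `U`.  Then along the link curve `s ↦ (e^{sY} U(e), U(e'))` — which stays on
the manifold — the series `∑_k f_k` has derivative `∑_k (∂_{e,Y} f_k)` at every parameter. [ours] -/
theorem hasDerivAt_tsum_linkCurve {f : ℕ → AmbConfig d L n → ℝ} (hf : ∀ k, Differentiable ℝ (f k))
    (e : Edge d L) {Y : Matrix (Fin n) (Fin n) ℂ} (hY : Y ∈ suAlgebra n) {u : ℕ → ℝ} (hu : Summable u)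
    (hb : ∀ (k : ℕ) (U : GaugeConfig d L (Matrix.specialUnitaryGroup (Fin n) ℂ)),
      |linkDeriv e Y (f k) (WilsonFlow.coeConfig U)| ≤ u k)
    (U : GaugeConfig d L (Matrix.specialUnitaryGroup (Fin n) ℂ))
    (h0 : Summable fun k => f k (WilsonFlow.coeConfig U)) (s : ℝ) :
    HasDerivAt (fun s : ℝ => ∑' k, f k (Function.update (WilsonFlow.coeConfig U) e
        (NormedSpace.exp ((s : ℂ) • Y) * WilsonFlow.coeConfig U e)))
      (∑' k, linkDeriv e Y (f k) (Function.update (WilsonFlow.coeConfig U) e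
        (NormedSpace.exp ((s : ℂ) • Y) * WilsonFlow.coeConfig U e))) s := by
  refine hasDerivAt_tsum hu (fun k s => hasDerivAt_comp_linkCurve_at (hf k) _ e Y s) (fun k s => ?_)
    (y₀ := 0) ?_ s
  · rw [Real.norm_eq_abs, linkCurve_coeConfig hY U e s]
    exact hb k _
  · simpa only [linkCurve_zero] using h0

/-- **Termwise link derivative on the manifold**: under the hypotheses of `hasDerivAt_tsum_linkCurve`,
`∂_{e,Y} (∑_k f_k)(ιU) = ∑_k (∂_{e,Y} f_k)(ιU)`. [ours] -/
theorem linkDeriv_tsum_coeConfig {f : ℕ → AmbConfig d L n → ℝ} (hf : ∀ k, Differentiable ℝ (f k))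
    (e : Edge d L) {Y : Matrix (Fin n) (Fin n) ℂ} (hY : Y ∈ suAlgebra n) {u : ℕ → ℝ} (hu : Summable u)
    (hb : ∀ (k : ℕ) (U : GaugeConfig d L (Matrix.specialUnitaryGroup (Fin n) ℂ)),
      |linkDeriv e Y (f k) (WilsonFlow.coeConfig U)| ≤ u k)
    (U : GaugeConfig d L (Matrix.specialUnitaryGroup (Fin n) ℂ))
    (h0 : Summable fun k => f k (WilsonFlow.coeConfig U)) :
    linkDeriv e Y (fun W => ∑' k, f k W) (WilsonFlow.coeConfig U) =
      ∑' k, linkDeriv e Y (f k) (WilsonFlow.coeConfig U) := by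
  have h := (hasDerivAt_tsum_linkCurve hf e hY hu hb U h0 0).deriv
  simp only [linkCurve_zero] at h
  exact h

omit [NeZero L] in
/-- The termwise derivative series converges absolutely on the manifold (comparison). [ours] -/
theorem summable_linkDeriv_coeConfig {f : ℕ → AmbConfig d L n → ℝ} (e : Edge d L)
    {Y : Matrix (Fin n) (Fin n) ℂ} {u : ℕ → ℝ} (hu : Summable u)
    (hb : ∀ (k : ℕ) (U : GaugeConfig d L (Matrix.specialUnitaryGroup (Fin n) ℂ)),
      |linkDeriv e Y (f k) (WilsonFlow.coeConfig U)| ≤ u k)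
    (U : GaugeConfig d L (Matrix.specialUnitaryGroup (Fin n) ℂ)) :
    Summable fun k => linkDeriv e Y (f k) (WilsonFlow.coeConfig U) :=
  Summable.of_norm_bounded hu fun k => by rw [Real.norm_eq_abs]; exact hb k U

/-! ## §2. A power series in `t` with smooth coefficients: values, gradients, Laplacian -/

section PowerSeries

variable (B : SuBasis n) {Sk : ℕ → AmbConfig d L n → ℝ} {M₀ M₁ M₂ : ℕ → ℝ} {t : ℝ}

omit [NeZero L] in
/-- Comparison: a manifold majorant `|g_k(ιU)| ≤ M k` with `∑ |t|^k M k < ∞` makes `∑ t^k g_k(ιU)` absolutely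
convergent. [ours] -/
theorem summable_pow_mul_of_le {g : ℕ → ℝ} {M : ℕ → ℝ} (hM : Summable fun k => |t| ^ k * M k)
    (hg : ∀ k, |g k| ≤ M k) : Summable fun k => t ^ k * g k :=
  Summable.of_norm_bounded hM fun k => by
    rw [Real.norm_eq_abs, abs_mul, abs_pow]
    exact mul_le_mul_of_nonneg_left (hg k) (pow_nonneg (abs_nonneg t) k)

/-- **The gradient of the `t`-series is the `t`-series of the gradients** on `SU(n)^E`, whenever the values
and the link gradients of the coefficients have manifold majorants `M₀, M₁` with `∑ |t|^k Mⱼ(k) < ∞`. [ours] -/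
theorem linkDeriv_tSeries (hSk : ∀ k, ContDiff ℝ ∞ (Sk k))
    (h0 : ∀ (k : ℕ) (U : GaugeConfig d L (Matrix.specialUnitaryGroup (Fin n) ℂ)),
      |Sk k (WilsonFlow.coeConfig U)| ≤ M₀ k)
    (h1 : ∀ (k : ℕ) (U : GaugeConfig d L (Matrix.specialUnitaryGroup (Fin n) ℂ)) (e : Edge d L) (a : B.ι),
      |linkDeriv e (B.T a) (Sk k) (WilsonFlow.coeConfig U)| ≤ M₁ k)
    (hM₀ : Summable fun k => |t| ^ k * M₀ k) (hM₁ : Summable fun k => |t| ^ k * M₁ k)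
    (U : GaugeConfig d L (Matrix.specialUnitaryGroup (Fin n) ℂ)) (e : Edge d L) (a : B.ι) :
    linkDeriv e (B.T a) (fun W => ∑' k, t ^ k * Sk k W) (WilsonFlow.coeConfig U) =
      ∑' k, t ^ k * linkDeriv e (B.T a) (Sk k) (WilsonFlow.coeConfig U) := by
  have hf : ∀ k, Differentiable ℝ (fun W => t ^ k * Sk k W) := fun k =>
    ((hSk k).differentiable (by simp)).const_mul _
  have hb : ∀ (k : ℕ) (V : GaugeConfig d L (Matrix.specialUnitaryGroup (Fin n) ℂ)),
      |linkDeriv e (B.T a) (fun W => t ^ k * Sk k W) (WilsonFlow.coeConfig V)| ≤ |t| ^ k * M₁ k := by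
    intro k V
    rw [linkDeriv_const_mul', abs_mul, abs_pow]
    exact mul_le_mul_of_nonneg_left (h1 k V e a) (pow_nonneg (abs_nonneg t) k)
  have h := linkDeriv_tsum_coeConfig hf e (B.mem a) hM₁ hb U (summable_pow_mul_of_le hM₀ fun k => h0 k U)
  simp only [linkDeriv_const_mul'] at h
  exact h

omit [NeZero L] in
/-- The gradient series converges absolutely on the manifold. [ours] -/
theorem summable_linkDeriv_tSeries
    (h1 : ∀ (k : ℕ) (U : GaugeConfig d L (Matrix.specialUnitaryGroup (Fin n) ℂ)) (e : Edge d L) (a : B.ι),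
      |linkDeriv e (B.T a) (Sk k) (WilsonFlow.coeConfig U)| ≤ M₁ k)
    (hM₁ : Summable fun k => |t| ^ k * M₁ k)
    (U : GaugeConfig d L (Matrix.specialUnitaryGroup (Fin n) ℂ)) (e : Edge d L) (a : B.ι) :
    Summable fun k => t ^ k * linkDeriv e (B.T a) (Sk k) (WilsonFlow.coeConfig U) :=
  summable_pow_mul_of_le hM₁ fun k => h1 k U e a

/-- **The repeated link derivative passes through the sum**: with majorants `M₀, M₁, M₂` for values,
gradients and `∂^a_e∂^a_e S̃^{(k)}` on the manifold, `∂^a_e ∂^a_e (∑ t^k S̃^{(k)})(ιU) = ∑ t^k (∂^a_e∂^a_e S̃^{(k)})(ιU)`.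
(The inner derivative `∂^a_e ∑ t^k S̃^{(k)}` is only known to be the termwise series ON the manifold; that is all
the outer link derivative sees, `linkDeriv_coeConfig_congr`.) [ours] -/
theorem linkDeriv_linkDeriv_tSeries (hSk : ∀ k, ContDiff ℝ ∞ (Sk k))
    (h0 : ∀ (k : ℕ) (U : GaugeConfig d L (Matrix.specialUnitaryGroup (Fin n) ℂ)),
      |Sk k (WilsonFlow.coeConfig U)| ≤ M₀ k)
    (h1 : ∀ (k : ℕ) (U : GaugeConfig d L (Matrix.specialUnitaryGroup (Fin n) ℂ)) (e : Edge d L) (a : B.ι),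
      |linkDeriv e (B.T a) (Sk k) (WilsonFlow.coeConfig U)| ≤ M₁ k)
    (h2 : ∀ (k : ℕ) (U : GaugeConfig d L (Matrix.specialUnitaryGroup (Fin n) ℂ)) (e : Edge d L) (a : B.ι),
      |linkDeriv e (B.T a) (linkDeriv e (B.T a) (Sk k)) (WilsonFlow.coeConfig U)| ≤ M₂ k)
    (hM₀ : Summable fun k => |t| ^ k * M₀ k) (hM₁ : Summable fun k => |t| ^ k * M₁ k)
    (hM₂ : Summable fun k => |t| ^ k * M₂ k)
    (U : GaugeConfig d L (Matrix.specialUnitaryGroup (Fin n) ℂ)) (e : Edge d L) (a : B.ι) :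
    linkDeriv e (B.T a) (linkDeriv e (B.T a) (fun W => ∑' k, t ^ k * Sk k W)) (WilsonFlow.coeConfig U) =
      ∑' k, t ^ k * linkDeriv e (B.T a) (linkDeriv e (B.T a) (Sk k)) (WilsonFlow.coeConfig U) := by
  -- on the manifold the inner derivative is the termwise series
  have hcongr := linkDeriv_coeConfig_congr (φ := linkDeriv e (B.T a) (fun W => ∑' k, t ^ k * Sk k W))
    (ψ := fun W => ∑' k, t ^ k * linkDeriv e (B.T a) (Sk k) W)
    (fun V => linkDeriv_tSeries B hSk h0 h1 hM₀ hM₁ V e a) e (B.mem a) U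
  rw [hcongr]
  -- and that series may be differentiated termwise once more
  have hf : ∀ k, Differentiable ℝ (fun W => t ^ k * linkDeriv e (B.T a) (Sk k) W) := fun k =>
    ((contDiff_linkDeriv (hSk k) e (B.T a)).differentiable (by simp)).const_mul _
  have hb : ∀ (k : ℕ) (V : GaugeConfig d L (Matrix.specialUnitaryGroup (Fin n) ℂ)),
      |linkDeriv e (B.T a) (fun W => t ^ k * linkDeriv e (B.T a) (Sk k) W) (WilsonFlow.coeConfig V)|
        ≤ |t| ^ k * M₂ k := by
    intro k V
    rw [linkDeriv_const_mul', abs_mul, abs_pow]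
    exact mul_le_mul_of_nonneg_left (h2 k V e a) (pow_nonneg (abs_nonneg t) k)
  have h := linkDeriv_tsum_coeConfig hf e (B.mem a) hM₂ hb U (summable_linkDeriv_tSeries B h1 hM₁ U e a)
  simp only [linkDeriv_const_mul'] at h
  exact h

/-- **Lüscher's Laplacian passes through the sum** on `SU(n)^E`:
`Δ(∑ t^k S̃^{(k)})(ιU) = ∑ t^k (Δ S̃^{(k)})(ιU)`. [ours] -/
theorem linkLap_tSeries (hSk : ∀ k, ContDiff ℝ ∞ (Sk k))
    (h0 : ∀ (k : ℕ) (U : GaugeConfig d L (Matrix.specialUnitaryGroup (Fin n) ℂ)),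
      |Sk k (WilsonFlow.coeConfig U)| ≤ M₀ k)
    (h1 : ∀ (k : ℕ) (U : GaugeConfig d L (Matrix.specialUnitaryGroup (Fin n) ℂ)) (e : Edge d L) (a : B.ι),
      |linkDeriv e (B.T a) (Sk k) (WilsonFlow.coeConfig U)| ≤ M₁ k)
    (h2 : ∀ (k : ℕ) (U : GaugeConfig d L (Matrix.specialUnitaryGroup (Fin n) ℂ)) (e : Edge d L) (a : B.ι),
      |linkDeriv e (B.T a) (linkDeriv e (B.T a) (Sk k)) (WilsonFlow.coeConfig U)| ≤ M₂ k)
    (hM₀ : Summable fun k => |t| ^ k * M₀ k) (hM₁ : Summable fun k => |t| ^ k * M₁ k)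
    (hM₂ : Summable fun k => |t| ^ k * M₂ k)
    (U : GaugeConfig d L (Matrix.specialUnitaryGroup (Fin n) ℂ)) :
    linkLap B (fun W => ∑' k, t ^ k * Sk k W) (WilsonFlow.coeConfig U) =
      ∑' k, t ^ k * linkLap B (Sk k) (WilsonFlow.coeConfig U) := by
  have hsum : ∀ (e : Edge d L) (a : B.ι),
      Summable fun k => t ^ k * linkDeriv e (B.T a) (linkDeriv e (B.T a) (Sk k)) (WilsonFlow.coeConfig U) :=
    fun e a => summable_pow_mul_of_le hM₂ fun k => h2 k U e a
  unfold linkLap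
  simp_rw [linkDeriv_linkDeriv_tSeries B hSk h0 h1 h2 hM₀ hM₁ hM₂ U]
  have hR : ∀ k, t ^ k * -∑ e : Edge d L, ∑ a : B.ι,
      linkDeriv e (B.T a) (linkDeriv e (B.T a) (Sk k)) (WilsonFlow.coeConfig U) =
      -∑ e : Edge d L, ∑ a : B.ι,
        t ^ k * linkDeriv e (B.T a) (linkDeriv e (B.T a) (Sk k)) (WilsonFlow.coeConfig U) := by
    intro k
    rw [mul_neg, Finset.mul_sum]
    simp_rw [Finset.mul_sum]
  simp_rw [hR]
  rw [tsum_neg, Summable.tsum_finsetSum (fun e _ => summable_sum fun a _ => hsum e a)]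
  congr 1
  exact Finset.sum_congr rfl fun e _ => (Summable.tsum_finsetSum fun a _ => hsum e a).symm

/-! ## §3. The summed series solves Lüscher's flow equation (4.5) -/

/-- A crude manifold bound for the Laplacian from the repeated-derivative majorant:
`|Δ S̃^{(k)}(ιU)| ≤ #E · #ι · M₂(k)`. [ours] -/
theorem abs_linkLap_coeConfig_le
    (h2 : ∀ (k : ℕ) (U : GaugeConfig d L (Matrix.specialUnitaryGroup (Fin n) ℂ)) (e : Edge d L) (a : B.ι),
      |linkDeriv e (B.T a) (linkDeriv e (B.T a) (Sk k)) (WilsonFlow.coeConfig U)| ≤ M₂ k)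
    (k : ℕ) (U : GaugeConfig d L (Matrix.specialUnitaryGroup (Fin n) ℂ)) :
    |linkLap B (Sk k) (WilsonFlow.coeConfig U)| ≤
      (Fintype.card (Edge d L) : ℝ) * (Fintype.card B.ι : ℝ) * M₂ k := by
  unfold linkLap
  rw [abs_neg]
  refine (Finset.abs_sum_le_sum_abs _ _).trans ?_
  have h : ∀ e ∈ (Finset.univ : Finset (Edge d L)),
      |∑ a : B.ι, linkDeriv e (B.T a) (linkDeriv e (B.T a) (Sk k)) (WilsonFlow.coeConfig U)|
        ≤ (Fintype.card B.ι : ℝ) * M₂ k := fun e _ =>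
    (Finset.abs_sum_le_sum_abs _ _).trans
      ((Finset.sum_le_sum fun a _ => h2 k U e a).trans
        (by rw [Finset.sum_const, Finset.card_univ, nsmul_eq_mul]))
  refine (Finset.sum_le_sum h).trans ?_
  rw [Finset.sum_const, Finset.card_univ, nsmul_eq_mul, mul_assoc]

variable {S : AmbConfig d L n → ℝ} {c : ℕ → ℝ}

/-- **The summed Lüscher series solves the flow equation (4.5) on the field manifold.**  Let
`(S̃^{(k)}, Ċ^{(k)})` be a smooth Lüscher series of the action `S` (recursion (4.12)–(4.15) on `SU(n)^E`) and let
`M₀, M₁, M₂` be manifold majorants of `|S̃^{(k)}|`, `|∂^a_e S̃^{(k)}|`, `|∂^a_e∂^a_e S̃^{(k)}|` with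
`∑_k |t|^k Mⱼ(k) < ∞` and `∑_k |t|^k |Ċ^{(k)}| < ∞`.  Then the flow action `S̃_t := ∑_k t^k S̃^{(k)}` solves
Lüscher's linear equation `𝓛_t S̃_t = S + Ċ_t` (4.5) at every `U ∈ SU(n)^E`, with `Ċ_t = ∑_k t^k Ċ^{(k)}` —
order by order exactly as in §4.3: `Δ S̃_t = (S + Ċ^{(0)}) + ∑_k t^{k+1}(-∂S·∂S̃^{(k)} + Ċ^{(k+1)})
= S + Ċ_t - t ∂S·∂S̃_t`. [cite: Luscher2010Trivializing, §4.2 eq. (4.5), §4.3 eqs. (4.11)–(4.13)] -/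
theorem luscherL_tSeries_eq (h : IsLuscherSeries B S Sk c) (hSk : ∀ k, ContDiff ℝ ∞ (Sk k))
    (h0 : ∀ (k : ℕ) (U : GaugeConfig d L (Matrix.specialUnitaryGroup (Fin n) ℂ)),
      |Sk k (WilsonFlow.coeConfig U)| ≤ M₀ k)
    (h1 : ∀ (k : ℕ) (U : GaugeConfig d L (Matrix.specialUnitaryGroup (Fin n) ℂ)) (e : Edge d L) (a : B.ι),
      |linkDeriv e (B.T a) (Sk k) (WilsonFlow.coeConfig U)| ≤ M₁ k)
    (h2 : ∀ (k : ℕ) (U : GaugeConfig d L (Matrix.specialUnitaryGroup (Fin n) ℂ)) (e : Edge d L) (a : B.ι),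
      |linkDeriv e (B.T a) (linkDeriv e (B.T a) (Sk k)) (WilsonFlow.coeConfig U)| ≤ M₂ k)
    (hM₀ : Summable fun k => |t| ^ k * M₀ k) (hM₁ : Summable fun k => |t| ^ k * M₁ k)
    (hM₂ : Summable fun k => |t| ^ k * M₂ k) (hc : Summable fun k => |t| ^ k * |c k|)
    (U : GaugeConfig d L (Matrix.specialUnitaryGroup (Fin n) ℂ)) :
    luscherL B S t (fun W => ∑' k, t ^ k * Sk k W) (WilsonFlow.coeConfig U) =
      S (WilsonFlow.coeConfig U) + ∑' k, t ^ k * c k := by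
  -- abbreviations
  set ιU := WilsonFlow.coeConfig U with hιU
  set Δ : ℕ → ℝ := fun k => linkLap B (Sk k) ιU with hΔdef
  set D : Edge d L → B.ι → ℕ → ℝ := fun e a k => linkDeriv e (B.T a) (Sk k) ιU with hDdef
  set sS : Edge d L → B.ι → ℝ := fun e a => linkDeriv e (B.T a) S ιU with hsSdef
  -- summabilities
  have hΔs : Summable fun k => t ^ k * Δ k :=
    summable_pow_mul_of_le (M := fun k => (Fintype.card (Edge d L) : ℝ) * (Fintype.card B.ι : ℝ) * M₂ k)
      (by simpa only [mul_left_comm _ ((Fintype.card (Edge d L) : ℝ) * _)] using hM₂.mul_left _)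
      fun k => abs_linkLap_coeConfig_le B h2 k U
  have hDs : ∀ e a, Summable fun k => t ^ k * D e a k := fun e a =>
    summable_linkDeriv_tSeries B h1 hM₁ U e a
  have hcs : Summable fun k => t ^ k * c k := summable_pow_mul_of_le hc fun k => le_rfl
  -- the two termwise formulas
  have hLap : linkLap B (fun W => ∑' k, t ^ k * Sk k W) ιU = ∑' k, t ^ k * Δ k :=
    linkLap_tSeries B hSk h0 h1 h2 hM₀ hM₁ hM₂ U
  have hGrad : ∀ e a, linkDeriv e (B.T a) (fun W => ∑' k, t ^ k * Sk k W) ιU = ∑' k, t ^ k * D e a k := fun e a =>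
    linkDeriv_tSeries B hSk h0 h1 hM₀ hM₁ U e a
  -- the recursion, order by order
  have hΔ0 : Δ 0 = S ιU + c 0 := h.1 U
  have hΔsucc : ∀ k, t ^ (k + 1) * Δ (k + 1) =
      t ^ (k + 1) * c (k + 1) - t * ∑ e : Edge d L, ∑ a : B.ι, sS e a * (t ^ k * D e a k) := by
    intro k
    have hk : Δ (k + 1) = -(∑ e : Edge d L, ∑ a : B.ι, sS e a * D e a k) + c (k + 1) := h.2 k U
    rw [hk, Finset.mul_sum]
    simp_rw [Finset.mul_sum]
    have : ∀ (e : Edge d L) (a : B.ι), t * (sS e a * (t ^ k * D e a k)) = t ^ (k + 1) * (sS e a * D e a k) :=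
      fun e a => by ring
    simp_rw [this, ← Finset.mul_sum]
    ring
  -- summability of the pieces of the successor terms
  have hs1 : Summable fun k => t ^ (k + 1) * c (k + 1) := (summable_nat_add_iff 1).2 hcs
  have hs2 : Summable fun k => t * ∑ e : Edge d L, ∑ a : B.ι, sS e a * (t ^ k * D e a k) :=
    (summable_sum fun e _ => summable_sum fun a _ => (hDs e a).mul_left (sS e a)).mul_left t
  -- sum the successor terms
  have htail : ∑' k, t ^ (k + 1) * Δ (k + 1) =
      (∑' k, t ^ (k + 1) * c (k + 1)) - t * ∑ e : Edge d L, ∑ a : B.ι, sS e a * ∑' k, t ^ k * D e a k := by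
    simp_rw [hΔsucc]
    rw [Summable.tsum_sub hs1 hs2, Summable.tsum_mul_left,
      Summable.tsum_finsetSum (fun e _ => summable_sum fun a _ => (hDs e a).mul_left (sS e a))]
    · congr 2
      refine Finset.sum_congr rfl fun e _ => ?_
      rw [Summable.tsum_finsetSum (fun a _ => (hDs e a).mul_left (sS e a))]
      exact Finset.sum_congr rfl fun a _ => (hDs e a).tsum_mul_left (sS e a)
    · exact summable_sum fun e _ => summable_sum fun a _ => (hDs e a).mul_left (sS e a)
  -- assemble
  have hc0 : c 0 + ∑' k, t ^ (k + 1) * c (k + 1) = ∑' k, t ^ k * c k := by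
    rw [hcs.tsum_eq_zero_add, pow_zero, one_mul]
  unfold luscherL
  rw [hLap, hΔs.tsum_eq_zero_add, pow_zero, one_mul, hΔ0, htail, ← hc0]
  simp_rw [hGrad]
  ring

end PowerSeries

end SeriesSummation

end Summit.Ventures.LatticeQCDFlow.TrivializingMaps

end
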